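import Mathlib
import Summits.CriticalPhenomena.Ising3DConformalLimit.Theses.HarmonicMomentsIsotropy
import Summits.CriticalPhenomena.Ising3DConformalLimit.Theorems.HarmonicMomentsIsotropyHarmonicDilution
import Summits.CriticalPhenomena.Ising3DConformalLimit.Theorems.HarmonicMomentsIsotropyHarmonicDilutionSymmetric
import Summits.CriticalPhenomena.Ising3DConformalLimit.Theorems.HarmonicMomentsIsotropyHarmonicDilutionReynolds
import Summits.CriticalPhenomena.Ising3DConformalLimit.Theorems.HarmonicMomentsIsotropyDilutionTransferIsing
import HarnessLib

/-!
# Route HarmonicMomentsIsotropy — the hierarchy behind `HarmonicDilution`, reduced to invariant harmonics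

Item `stmt-CriticalPhenomena-6034` (`HarmonicDilution`: every anisotropy ratio
`a_{Y,m}(β) = k_{Y,m}(β) / M_{n+2m}(β)`, `k_{Y,m}(β) = ∑_x Y(x)|x|^{2m}⟨σ₀σ_x⟩^∅_β`,
`M_q(β) = ∑_x |x|^q ⟨σ₀σ_x⟩^∅_β` on `ℤ³`, of a harmonic homogeneous `Y` of degree `n ≥ 1` tends to
`0` as `β ↑ β_c(3)`) is the open Campostrini–Pelissetto–Rossi–Vicari prediction; inside the route it
is closed by `harmonicDilution_of_angularHierarchy : AngularHierarchy → HarmonicDilution`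
(`HarmonicMomentsIsotropyHarmonicDilution.lean`).  The earlier support files reduce the ITEM to the
`B₃`-invariant harmonics of even degree `n ≥ 4` (`harmonicDilution_iff_invariant`).  This file proves
the same reduction for the HYPOTHESIS, the crux `AngularHierarchy` (item stmt-CriticalPhenomena-6031:
the contraction `|k(β₂) - k(β₁)| ≤ (θ · sup_{[β₁,β₂]} |a| + ε) · (M_q(β₂) - M_q(β₁))`, `θ < 1`, of
the `β`-increments of every harmonic moment, inductively in the total degree `q = n + 2m`), and
hence a sharper closing route for the item:

* `angularHierarchy_iff_invariant` — `AngularHierarchy` is EQUIVALENT to the same hierarchy with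
  its conclusion asked only of the `B₃`-invariant harmonic homogeneous `Y` of even degree `n ≥ 4`
  (same induction hypothesis);
* `harmonicDilution_of_angularHierarchy_invariant` — the corresponding weaker sufficient hypothesis
  for `HarmonicDilution`.

Mechanism.  Off the invariant sector `k_{Y,m} ≡ 0` (lattice symmetry,
`harmonicMoment_eq_zero_of_symmetrization`), and a vanishing moment is trivially contracted with
`θ = 0` because `M_q` is non-decreasing in `β` on `[0, β_c)` (Griffiths' second inequality,
`isotropicMoment_mono`); on it, `k_{Y,m} = k_{RY,m}/48` with `RY` the (invariant, harmonic, homogeneous)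
Reynolds polynomial (`harmonicMoment_reynolds`).  The contraction inequality is transported along
any scalar relation `k₂ = c · k₁` on `[0, β_c)` with the same `θ` (`contraction_transfer`:
`sup |a₂| = |c| · sup |a₁|` by `Real.sSup_smul_of_nonneg`, and `ε ↦ ε/|c|`; `c = 0` falls back on
monotonicity) — the lemma is reused by the quartic reduction in
`HarmonicMomentsIsotropyHarmonicDilutionK4Hierarchy.lean`.  Pure bookkeeping; no new analytic input.
-/

namespace Summit.CriticalPhenomena.Ising3DConformalLimit.Theorems

open Filter Topology Set
open scoped Pointwise
open Literature.Probability.LatticeModels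
open Summit.CriticalPhenomena.Ising3DConformalLimit.Theses.HarmonicMomentsIsotropy

/-! ### Abstract bookkeeping: transporting the contraction inequality -/

/-- A moment that vanishes on `[0, β_c)` is contracted with `θ = 0`, provided the isotropic moment
`M` is non-decreasing there. -/
theorem contraction_of_eq_zero {k M : ℝ → ℝ} {βc : ℝ} (hβc : 0 < βc)
    (hk : ∀ β, 0 ≤ β → β < βc → k β = 0)
    (hM : ∀ β β', 0 ≤ β → β ≤ β' → β' < βc → M β ≤ M β') :
    ∃ θ : ℝ, θ < 1 ∧ ∀ ε : ℝ, 0 < ε → ∃ β₀ : ℝ, β₀ < βc ∧ ∀ β₁ β₂ : ℝ,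
      β₀ ≤ β₁ → β₁ < β₂ → β₂ < βc →
      |k β₂ - k β₁| ≤ (θ * sSup ((fun β => |k β / M β|) '' Set.Icc β₁ β₂) + ε) * (M β₂ - M β₁) :=
  ⟨0, zero_lt_one, fun ε hε => ⟨0, hβc, fun β₁ β₂ h₁ h₁₂ h₂ => by
    rw [hk β₂ (h₁.trans h₁₂.le) h₂, hk β₁ h₁ (h₁₂.trans h₂), sub_zero, abs_zero, zero_mul, zero_add]
    exact mul_nonneg hε.le (sub_nonneg.2 (hM β₁ β₂ h₁ h₁₂.le h₂))⟩⟩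

/-- **Transport of the contraction along a scalar relation.**  If `k₂ = c · k₁` on `[0, β_c)` and
`M` is non-decreasing there, then the contraction inequality (every `ε > 0`, some left
neighbourhood of `β_c`) for `k₁` relative to `M` implies the one for `k₂`, with the same `θ`:
`sup |k₂/M| = |c| · sup |k₁/M|` on every `[β₁, β₂] ⊂ [0, β_c)`, and `ε` is rescaled by `|c|`
(`c = 0`: `k₂` vanishes and monotonicity of `M` suffices). -/
theorem contraction_transfer {k₁ k₂ M : ℝ → ℝ} {βc c θ : ℝ} (hβc : 0 < βc)
    (hk : ∀ β, 0 ≤ β → β < βc → k₂ β = c * k₁ β)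
    (hM : ∀ β β', 0 ≤ β → β ≤ β' → β' < βc → M β ≤ M β')
    (h : ∀ ε : ℝ, 0 < ε → ∃ β₀ : ℝ, β₀ < βc ∧ ∀ β₁ β₂ : ℝ, β₀ ≤ β₁ → β₁ < β₂ → β₂ < βc →
      |k₁ β₂ - k₁ β₁| ≤
        (θ * sSup ((fun β => |k₁ β / M β|) '' Set.Icc β₁ β₂) + ε) * (M β₂ - M β₁)) :
    ∀ ε : ℝ, 0 < ε → ∃ β₀ : ℝ, β₀ < βc ∧ ∀ β₁ β₂ : ℝ, β₀ ≤ β₁ → β₁ < β₂ → β₂ < βc →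
      |k₂ β₂ - k₂ β₁| ≤
        (θ * sSup ((fun β => |k₂ β / M β|) '' Set.Icc β₁ β₂) + ε) * (M β₂ - M β₁) := by
  intro ε hε
  by_cases hc : c = 0
  · refine ⟨0, hβc, fun β₁ β₂ h₁ h₁₂ h₂ => ?_⟩
    have hk0 : ∀ β ∈ Set.Icc β₁ β₂, k₂ β = 0 := fun β hβ => by
      rw [hk β (h₁.trans hβ.1) (hβ.2.trans_lt h₂), hc, zero_mul]
    have himg : (fun β => |k₂ β / M β|) '' Set.Icc β₁ β₂ = {0} := by
      have h' : (fun β => |k₂ β / M β|) '' Set.Icc β₁ β₂ = (fun _ => (0 : ℝ)) '' Set.Icc β₁ β₂ :=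
        Set.image_congr fun β hβ => by rw [hk0 β hβ, zero_div, abs_zero]
      rw [h', (Set.nonempty_Icc.2 h₁₂.le).image_const]
    rw [hk0 β₂ ⟨h₁₂.le, le_rfl⟩, hk0 β₁ ⟨le_rfl, h₁₂.le⟩, sub_zero, abs_zero, himg,
      csSup_singleton, mul_zero, zero_add]
    exact mul_nonneg hε.le (sub_nonneg.2 (hM β₁ β₂ h₁ h₁₂.le h₂))
  · have hc' : 0 < |c| := abs_pos.2 hc
    obtain ⟨β₀, hβ₀, hh⟩ := h (ε / |c|) (div_pos hε hc')
    refine ⟨max β₀ 0, max_lt hβ₀ hβc, fun β₁ β₂ h₁ h₁₂ h₂ => ?_⟩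
    have h₀₁ : β₀ ≤ β₁ := (le_max_left _ _).trans h₁
    have h0₁ : 0 ≤ β₁ := (le_max_right _ _).trans h₁
    have hkI : ∀ β ∈ Set.Icc β₁ β₂, k₂ β = c * k₁ β := fun β hβ =>
      hk β (h0₁.trans hβ.1) (hβ.2.trans_lt h₂)
    set S : Set ℝ := (fun β => |k₁ β / M β|) '' Set.Icc β₁ β₂ with hS
    have himg : (fun β => |k₂ β / M β|) '' Set.Icc β₁ β₂ = |c| • S := by
      rw [hS, ← Set.image_smul, Set.image_image]
      refine Set.image_congr fun β hβ => ?_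
      rw [hkI β hβ, mul_div_assoc, abs_mul, smul_eq_mul]
    have hsup : sSup ((fun β => |k₂ β / M β|) '' Set.Icc β₁ β₂) = |c| * sSup S := by
      rw [himg, Real.sSup_smul_of_nonneg (abs_nonneg c), smul_eq_mul]
    have hmain := hh β₁ β₂ h₀₁ h₁₂ h₂
    rw [hkI β₂ ⟨h₁₂.le, le_rfl⟩, hkI β₁ ⟨le_rfl, h₁₂.le⟩, ← mul_sub, abs_mul, hsup]
    calc |c| * |k₁ β₂ - k₁ β₁|
        ≤ |c| * ((θ * sSup S + ε / |c|) * (M β₂ - M β₁)) := mul_le_mul_of_nonneg_left hmain hc'.le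
      _ = (θ * (|c| * sSup S) + ε) * (M β₂ - M β₁) := by
          field_simp

/-! ### Lattice inputs: monotone isotropic moments, the bottom of the induction -/

/-- Griffiths: the isotropic moments `M_q(β) = ∑_x |x|^q ⟨σ₀σ_x⟩^∅_β` are non-decreasing in `β`
on `[0, β_c(3))` (termwise `⟨σ₀σ_x⟩_β ≤ ⟨σ₀σ_x⟩_{β'}`, both families summable below `β_c`). -/
theorem isotropicMoment_mono (q : ℕ) :
    ∀ β β' : ℝ, 0 ≤ β → β ≤ β' → β' < criticalBeta 3 →
      (∑' x : Site 3, Real.sqrt (∑ i, ((x i : ℤ) : ℝ) ^ 2) ^ q * twoPointFree 3 β x) ≤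
        (∑' x : Site 3, Real.sqrt (∑ i, ((x i : ℤ) : ℝ) ^ 2) ^ q * twoPointFree 3 β' x) := by
  intro β β' hβ hββ' hβ'c
  exact (summable_moment hβ (hββ'.trans_lt hβ'c) q).tsum_le_tsum
    (fun x => mul_le_mul_of_nonneg_left (HarmonicMomentsIsotropy.Ising.G_mono hβ hββ' x)
      (pow_nonneg (Real.sqrt_nonneg _) _))
    (summable_moment (hβ.trans hββ') hβ'c q)

/-! ### The hierarchy reduced to the invariant harmonics -/

/-- **Reynolds reduction of the crux.**  `AngularHierarchy` (item stmt-CriticalPhenomena-6031) is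
equivalent to the same inductive statement whose conclusion — the contraction of the
`β`-increments of `k_{Y,m}` against those of `M_{n+2m}` with a factor `θ < 1` — is required only
for the `B₃`-INVARIANT harmonic homogeneous `Y` of even degree `n ≥ 4` (`Y(g v) = Y(v)` for all
`48` signed coordinate permutations `g`), the induction hypothesis (all lower anisotropy ratios tend
to `0`) being unchanged.  For odd `n` and for `n = 2` the moment `k_{Y,m}` vanishes identically and
`θ = 0` works by monotonicity of `M`; for even `n ≥ 4`, `k_{Y,m} = k_{RY,m}/48` on `[0, β_c)` and
the contraction for the Reynolds polynomial `RY` transports to `Y`. -/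
theorem angularHierarchy_iff_invariant :
    AngularHierarchy ↔
      ∀ q : ℕ,
        (∀ (n' m' : ℕ) (Y' : MvPolynomial (Fin 3) ℝ), 1 ≤ n' → n' + 2 * m' < q →
          Y'.IsHomogeneous n' → (∑ i : Fin 3, MvPolynomial.pderiv i (MvPolynomial.pderiv i Y')) = 0 →
          Tendsto (fun β => (∑' x : Site 3, MvPolynomial.eval (fun i => ((x i : ℤ) : ℝ)) Y' *
                Real.sqrt (∑ i, ((x i : ℤ) : ℝ) ^ 2) ^ (2 * m') * twoPointFree 3 β x) /
              (∑' x : Site 3,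
                Real.sqrt (∑ i, ((x i : ℤ) : ℝ) ^ 2) ^ (n' + 2 * m') * twoPointFree 3 β x))
            (𝓝[<] criticalBeta 3) (𝓝 0)) →
        ∀ (n m : ℕ) (Y : MvPolynomial (Fin 3) ℝ), 4 ≤ n → Even n → n + 2 * m = q →
          Y.IsHomogeneous n → (∑ i : Fin 3, MvPolynomial.pderiv i (MvPolynomial.pderiv i Y)) = 0 →
          (∀ (π : Equiv.Perm (Fin 3)) (ε : Fin 3 → ℤˣ) (v : Fin 3 → ℝ),
            MvPolynomial.eval (fun i => ((ε i : ℤ) : ℝ) * v (π.symm i)) Y = MvPolynomial.eval v Y) →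
          ∃ θ : ℝ, θ < 1 ∧ ∀ ε : ℝ, 0 < ε → ∃ β₀ : ℝ, β₀ < criticalBeta 3 ∧ ∀ β₁ β₂ : ℝ,
            β₀ ≤ β₁ → β₁ < β₂ → β₂ < criticalBeta 3 →
            |(∑' x : Site 3, MvPolynomial.eval (fun i => ((x i : ℤ) : ℝ)) Y *
                  Real.sqrt (∑ i, ((x i : ℤ) : ℝ) ^ 2) ^ (2 * m) * twoPointFree 3 β₂ x) -
                (∑' x : Site 3, MvPolynomial.eval (fun i => ((x i : ℤ) : ℝ)) Y *
                    Real.sqrt (∑ i, ((x i : ℤ) : ℝ) ^ 2) ^ (2 * m) * twoPointFree 3 β₁ x)| ≤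
              (θ * sSup ((fun β => |(∑' x : Site 3, MvPolynomial.eval (fun i => ((x i : ℤ) : ℝ)) Y *
                      Real.sqrt (∑ i, ((x i : ℤ) : ℝ) ^ 2) ^ (2 * m) * twoPointFree 3 β x) /
                  (∑' x : Site 3,
                    Real.sqrt (∑ i, ((x i : ℤ) : ℝ) ^ 2) ^ (n + 2 * m) * twoPointFree 3 β x)|) '' Set.Icc β₁ β₂) + ε) *
                ((∑' x : Site 3,
                  Real.sqrt (∑ i, ((x i : ℤ) : ℝ) ^ 2) ^ (n + 2 * m) * twoPointFree 3 β₂ x) -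
                  (∑' x : Site 3,
                    Real.sqrt (∑ i, ((x i : ℤ) : ℝ) ^ 2) ^ (n + 2 * m) * twoPointFree 3 β₁ x)) := by
  have hβc : 0 < criticalBeta 3 := criticalBeta_pos_holds (by norm_num)
  dsimp only [AngularHierarchy]
  constructor
  · intro h q ih n m Y hn _ hq hY hΔ _
    exact h q ih n m Y (by omega) hq hY hΔ
  · intro h q ih n m Y hn hq hY hΔ
    rcases Nat.even_or_odd n with he | ho
    · by_cases h4 : 4 ≤ n
      · -- even degree `n ≥ 4`: transport from the Reynolds polynomial
        set R : MvPolynomial (Fin 3) ℝ := ∑ g : Equiv.Perm (Fin 3) × (Fin 3 → ℤˣ),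
          MvPolynomial.aeval
            (fun i => MvPolynomial.C ((g.2 i : ℤ) : ℝ) * MvPolynomial.X (g.1.symm i)) Y with hR
        have hRhom : R.IsHomogeneous n :=
          MvPolynomial.IsHomogeneous.sum _ _ _ fun g _ => isHomogeneous_signedPermAct g.1 g.2 hY
        have hRΔ : ∑ i : Fin 3, MvPolynomial.pderiv i (MvPolynomial.pderiv i R) = 0 := by
          rw [hR]
          simp_rw [map_sum]
          rw [Finset.sum_comm]
          exact Finset.sum_eq_zero fun g _ => laplacian_signedPermAct g.1 g.2 hΔ
        have hRinv : ∀ (π : Equiv.Perm (Fin 3)) (ε : Fin 3 → ℤˣ) (v : Fin 3 → ℝ),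
            MvPolynomial.eval (fun i => ((ε i : ℤ) : ℝ) * v (π.symm i)) R =
              MvPolynomial.eval v R :=
          fun π ε v => eval_reynolds_signedPerm Y π ε v
        obtain ⟨θ, hθ, hcR⟩ := h q ih n m R h4 he hq hRhom hRΔ hRinv
        refine ⟨θ, hθ, contraction_transfer (c := 1 / 48) (θ := θ)
          (k₁ := fun β => (∑' x : Site 3, MvPolynomial.eval (fun i => ((x i : ℤ) : ℝ)) R *
                Real.sqrt (∑ i, ((x i : ℤ) : ℝ) ^ 2) ^ (2 * m) * twoPointFree 3 β x))
          (k₂ := fun β => (∑' x : Site 3, MvPolynomial.eval (fun i => ((x i : ℤ) : ℝ)) Y *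
                Real.sqrt (∑ i, ((x i : ℤ) : ℝ) ^ 2) ^ (2 * m) * twoPointFree 3 β x))
          (M := fun β => (∑' x : Site 3,
              Real.sqrt (∑ i, ((x i : ℤ) : ℝ) ^ 2) ^ (n + 2 * m) * twoPointFree 3 β x))
          hβc (fun β hβ0 hβ => ?_) (isotropicMoment_mono (n + 2 * m)) hcR⟩
        show _ = 1 / 48 * _
        rw [hR, harmonicMoment_reynolds hβ0 hβ Y hY m]
        ring
      · -- `n = 2`: the full hyperoctahedral symmetrisation vanishes, `k ≡ 0`
        have hn2 : n = 2 := by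
          obtain ⟨k, rfl⟩ := he
          omega
        subst hn2
        exact contraction_of_eq_zero
          (k := fun β => (∑' x : Site 3, MvPolynomial.eval (fun i => ((x i : ℤ) : ℝ)) Y *
                Real.sqrt (∑ i, ((x i : ℤ) : ℝ) ^ 2) ^ (2 * m) * twoPointFree 3 β x))
          (M := fun β => (∑' x : Site 3,
              Real.sqrt (∑ i, ((x i : ℤ) : ℝ) ^ 2) ^ (2 + 2 * m) * twoPointFree 3 β x))
          hβc (fun β _ _ => harmonicMoment_eq_zero_of_symmetrization β Y Finset.univ_nonempty
            (symmetrization_eq_zero_of_degree_two Y hY hΔ) m) (isotropicMoment_mono (2 + 2 * m))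
    · -- odd `n`: `Y(-v) = -Y(v)`, `k ≡ 0`
      exact contraction_of_eq_zero
        (k := fun β => (∑' x : Site 3, MvPolynomial.eval (fun i => ((x i : ℤ) : ℝ)) Y *
              Real.sqrt (∑ i, ((x i : ℤ) : ℝ) ^ 2) ^ (2 * m) * twoPointFree 3 β x))
        (M := fun β => (∑' x : Site 3,
              Real.sqrt (∑ i, ((x i : ℤ) : ℝ) ^ 2) ^ (n + 2 * m) * twoPointFree 3 β x))
        hβc (fun β _ _ => harmonicMoment_eq_zero_of_symmetrization β Y
          (Finset.insert_nonempty _ _) (symmetrization_eq_zero_of_odd ho Y hY) m)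
        (isotropicMoment_mono (n + 2 * m))

/-- **A weaker sufficient hypothesis for the item.**  `HarmonicDilution`
(item stmt-CriticalPhenomena-6034) follows from the angular hierarchy restricted to the
`B₃`-invariant harmonic homogeneous `Y` of even degree `n ≥ 4`. -/
theorem harmonicDilution_of_angularHierarchy_invariant
    (h :
      ∀ q : ℕ,
        (∀ (n' m' : ℕ) (Y' : MvPolynomial (Fin 3) ℝ), 1 ≤ n' → n' + 2 * m' < q →
          Y'.IsHomogeneous n' → (∑ i : Fin 3, MvPolynomial.pderiv i (MvPolynomial.pderiv i Y')) = 0 →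
          Tendsto (fun β => (∑' x : Site 3, MvPolynomial.eval (fun i => ((x i : ℤ) : ℝ)) Y' *
                Real.sqrt (∑ i, ((x i : ℤ) : ℝ) ^ 2) ^ (2 * m') * twoPointFree 3 β x) /
              (∑' x : Site 3,
                Real.sqrt (∑ i, ((x i : ℤ) : ℝ) ^ 2) ^ (n' + 2 * m') * twoPointFree 3 β x))
            (𝓝[<] criticalBeta 3) (𝓝 0)) →
        ∀ (n m : ℕ) (Y : MvPolynomial (Fin 3) ℝ), 4 ≤ n → Even n → n + 2 * m = q →
          Y.IsHomogeneous n → (∑ i : Fin 3, MvPolynomial.pderiv i (MvPolynomial.pderiv i Y)) = 0 →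
          (∀ (π : Equiv.Perm (Fin 3)) (ε : Fin 3 → ℤˣ) (v : Fin 3 → ℝ),
            MvPolynomial.eval (fun i => ((ε i : ℤ) : ℝ) * v (π.symm i)) Y = MvPolynomial.eval v Y) →
          ∃ θ : ℝ, θ < 1 ∧ ∀ ε : ℝ, 0 < ε → ∃ β₀ : ℝ, β₀ < criticalBeta 3 ∧ ∀ β₁ β₂ : ℝ,
            β₀ ≤ β₁ → β₁ < β₂ → β₂ < criticalBeta 3 →
            |(∑' x : Site 3, MvPolynomial.eval (fun i => ((x i : ℤ) : ℝ)) Y *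
                  Real.sqrt (∑ i, ((x i : ℤ) : ℝ) ^ 2) ^ (2 * m) * twoPointFree 3 β₂ x) -
                (∑' x : Site 3, MvPolynomial.eval (fun i => ((x i : ℤ) : ℝ)) Y *
                    Real.sqrt (∑ i, ((x i : ℤ) : ℝ) ^ 2) ^ (2 * m) * twoPointFree 3 β₁ x)| ≤
              (θ * sSup ((fun β => |(∑' x : Site 3, MvPolynomial.eval (fun i => ((x i : ℤ) : ℝ)) Y *
                      Real.sqrt (∑ i, ((x i : ℤ) : ℝ) ^ 2) ^ (2 * m) * twoPointFree 3 β x) /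
                  (∑' x : Site 3,
                    Real.sqrt (∑ i, ((x i : ℤ) : ℝ) ^ 2) ^ (n + 2 * m) * twoPointFree 3 β x)|) '' Set.Icc β₁ β₂) + ε) *
                ((∑' x : Site 3,
                  Real.sqrt (∑ i, ((x i : ℤ) : ℝ) ^ 2) ^ (n + 2 * m) * twoPointFree 3 β₂ x) -
                  (∑' x : Site 3,
                    Real.sqrt (∑ i, ((x i : ℤ) : ℝ) ^ 2) ^ (n + 2 * m) * twoPointFree 3 β₁ x))) :
    HarmonicDilution :=
  harmonicDilution_of_angularHierarchy (angularHierarchy_iff_invariant.2 h)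

end Summit.CriticalPhenomena.Ising3DConformalLimit.Theorems
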